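import Literature.Barriers.NavierStokesRegularity.NavierStokesInequalityProfilesProofs
import Literature.Barriers.NavierStokesRegularity.NavierStokesInequalitySingularSolutionHolds
import Summits.NavierStokesRegularity.NavierStokesRegularity.Theses.TypeILiouville
import HarnessLib

/-!
# Negative lane of `NoTypeII`: a classical NSI block with SUPER-similar gain (brick B1)

Support file (`--supports stmt-NavierStokesRegularity-0056`, the residual `NoTypeII` of the
Type-I Liouville door) for the model-class counterexample «the Navier–Stokes INEQUALITY admits
Type-II blow-up» (HOME bus: critic-1 `KREAD-03-NSIFirstBlowupIsTypeI.md` §6, lit-coord barrier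
spec `NSITypeIIBlowup`, critic-2 concurrence). It discharges the first of the three bricks of that
counterexample as a kernel theorem:

* `exists_superGain_nsiBlock` — **there is a classical block `(T, ν₀, τ, z, G, u)` of the
  Navier–Stokes inequality (tree: `IsNSIBlock`, Ożański 2017, Prop. 4.2 / Scheffer 1985,
  Lemma 3.3) whose gain of magnitude along the similarity `Γx = τx + z` is STRICTLY
  super-similar: `g·|u(x,0)| ≤ |u(Γx,T)|` for all `x`, with `g > τ⁻¹`** (indeed for every
  `g ≤ g₀`, some `g₀ > τ⁻¹`). The printed block only records `g = τ⁻¹` ((2.2), the `gain` field of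
  `IsNSIBlock`), which forces the self-similar time ratio `τ²` and a Type-I rate
  (`not_isTypeIIBlowup_glue`); with `g > τ⁻¹` the pieces `gʲ u((t - tⱼ)/σʲ, ·/τʲ)`, `σ = τ/g < τ²·(gτ)⁻¹`,
  still satisfy the NSI (two-parameter covariance, `nsi_superPiece` of `NSISuperSimilarSeed`) and
  drop in magnitude at the switching times, while `(T₀ - t)^{1/2}‖𝔲(t)‖_∞ ≥ c (gτ)^{j/2} → ∞`:
  a Type-II blow-up inside the NSI class (bricks B2–B3, not in this file).

The proof is Ożański's §4 verbatim with one observation: the gain inequality (4.11) of Lemma 4.1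
is STRICT with a uniform margin `θ > 0` on the compact set `G` (tree: the `gain`/`θ_pos` fields of
`IsHProfileData`), and `f₁ + f₂` is bounded, so `τ⁻²(f₁ + f₂)² + θ ≥ g²(f₁ + f₂)² + θ/2` for some
`g > τ⁻¹`; running the §4.1–4.2 construction with tolerance `ε ≤ θ/2` (instead of `ε ≤ θ`) the
profiles `qᵏ` inherit the gain `g` (`superGain_qProf`, twin of `IsQData.gain_qProf`), and the block
`u = u[a₁ᵏv₁, qᵏ₁] + u[a₂ᵏv₂, qᵏ₂]` (tree: `profileField`, `IsNSIProfileData.isNSIBlock_profileField`)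
is unchanged. Applied to the proved arrangement (`NSIArrangementExists_holds`, Ożański §5 / §6.5)
this gives the unconditional existence statement.

Nothing here asserts a Theses statement; the file is negative-lane support (D-0016): any proof of
`NoTypeII` must use a property of Navier–Stokes solutions that fails for the NSI class with
super-similar blocks.

## References

* W. S. Ożański, *On weak solutions to the Navier–Stokes inequality with internal
  singularities*, arXiv:1709.00602v4, §2 (2.2), Lemma 4.1 (4.11), §4.1–4.2 ((4.16)–(4.20),
  Prop. 4.2), §5. [`Ozanski2017NSISingular`]
* V. Scheffer, *A solution to the Navier–Stokes inequality with an internal singularity*,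
  Comm. Math. Phys. 101 (1985), 47–85, Lemmas 2.1, 3.1–3.3. [`Scheffer1985`]
-/

noncomputable section

open Set Function Filter Topology Metric MeasureTheory

set_option linter.dupNamespace false

namespace Summit.NavierStokesRegularity.NavierStokesRegularity.Theorems.TypeIliouvilleNoTypeIINegative

open Literature.Analysis.FluidPDE Literature.Barriers.NavierStokesRegularity
open Literature.Barriers.NavierStokesRegularity.IsQData

/-! ### The profiles `qᵏ` inherit any gain `g` with margin ((4.11) with `θ/2`) -/

section QLevel

variable {U : Fin 2 → Set (ℝ × ℝ)} {V : Fin 2 → ℝ × ℝ → ℝ × ℝ} {f φ ψ : Fin 2 → ℝ × ℝ → ℝ}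
  {H : Fin 2 → ℝ → ℝ × ℝ → ℝ} {T δ : ℝ} {κ : ℝ → ℝ} {a : ℕ → Fin 2 → ℝ → ℝ}

/-- **The gain `qᵏ_{1,T} + qᵏ_{2,T} ≥ g (f₁ + f₂) ∘ R⁻¹` along `Γ` on `G`** for ANY `g ≥ 0` with
`g²(f₁ + f₂)²(R⁻¹x) + θ' ≤ h²_{2,T}(R⁻¹(Γx))` on `G` and a good index at tolerance `ε ≤ θ'`
(twin of `IsQData.gain_qProf`, which is the case `g = τ⁻¹`).
[cite: Ozanski2017NSISingular, §4 (after Prop. 4.2) and Lemma 4.1 (4.11)] -/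
theorem superGain_qProf (hQ : IsQData U V f φ ψ H T δ κ a) {k : ℕ} {ε : ℝ} (hg : Good a V H T k ε)
    {τ : ℝ} {z : EuclideanSpace ℝ (Fin 3)} {g θ' : ℝ} (hg0 : 0 ≤ g) (hεθ : ε ≤ θ')
    (hgain : ∀ x ∈ revolve (closure (U 0) ∪ closure (U 1)),
      g ^ 2 * (f 0 (meridian x) + f 1 (meridian x)) ^ 2 + θ' ≤ H 1 T (meridian (τ • x + z)) ^ 2)
    {x : EuclideanSpace ℝ (Fin 3)} (hx : x ∈ revolve (closure (U 0) ∪ closure (U 1))) :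
    g * (qProf f φ δ κ a V H k 0 0 (meridian x) + qProf f φ δ κ a V H k 1 0 (meridian x)) ≤
      qProf f φ δ κ a V H k 0 T (meridian (τ • x + z)) +
        qProf f φ δ κ a V H k 1 T (meridian (τ • x + z)) := by
  have hT : T ∈ Icc (0 : ℝ) T := ⟨hQ.T_pos.le, le_rfl⟩
  rw [hQ.qProf_zero k 0, hQ.qProf_zero k 1]
  have h0 : 0 ≤ qProf f φ δ κ a V H k 0 T (meridian (τ • x + z)) := qProf_nonneg k 0 T _
  have hf : 0 ≤ g * (f 0 (meridian x) + f 1 (meridian x)) :=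
    mul_nonneg hg0
      (add_nonneg ((hQ.isNSIStructure 0).f_nonneg _) ((hQ.isNSIStructure 1).f_nonneg _))
  have h1 : g * (f 0 (meridian x) + f 1 (meridian x)) ≤
      qProf f φ δ κ a V H k 1 T (meridian (τ • x + z)) := by
    have e := hQ.qRad_sub_H_sq k 1 (hQ.κ_eq T hT) (meridian (τ • x + z))
    have hb := (abs_le.1 (hg T hT (meridian (τ • x + z)) 1).1).2
    have hgx := hgain x hx
    have hq : (g * (f 0 (meridian x) + f 1 (meridian x))) ^ 2 ≤
        qRad f φ δ κ a V H k 1 T (meridian (τ • x + z)) := by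
      rw [mul_pow]; linarith
    calc g * (f 0 (meridian x) + f 1 (meridian x))
        = Real.sqrt ((g * (f 0 (meridian x) + f 1 (meridian x))) ^ 2) := (Real.sqrt_sq hf).symm
      _ ≤ qProf f φ δ κ a V H k 1 T (meridian (τ • x + z)) := Real.sqrt_le_sqrt hq
  linarith

/-- **A strict gain margin yields a super-similar gain constant**: if
`τ⁻²(f₁ + f₂)²(R⁻¹x) + θ ≤ h²_{2,T}(R⁻¹(Γx))` on `G` with `θ > 0` ((4.11)), then for some
`g > τ⁻¹` also `g²(f₁ + f₂)²(R⁻¹x) + θ/2 ≤ h²_{2,T}(R⁻¹(Γx))` on `G` (`f₁ + f₂` is bounded: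
`supp fᵢ = Ūᵢ` compact). [cite: Ozanski2017NSISingular, Lemma 4.1 (4.11) and (4.8)] -/
theorem exists_superGain_margin (hQ : IsQData U V f φ ψ H T δ κ a) {τ : ℝ} (hτ : 0 < τ) {z : EuclideanSpace ℝ (Fin 3)}
    {θ : ℝ} (hθ : 0 < θ)
    (hgain : ∀ x ∈ revolve (closure (U 0) ∪ closure (U 1)),
      τ⁻¹ ^ 2 * (f 0 (meridian x) + f 1 (meridian x)) ^ 2 + θ ≤ H 1 T (meridian (τ • x + z)) ^ 2) :
    ∃ g : ℝ, τ⁻¹ < g ∧ ∀ x ∈ revolve (closure (U 0) ∪ closure (U 1)),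
      g ^ 2 * (f 0 (meridian x) + f 1 (meridian x)) ^ 2 + θ / 2 ≤ H 1 T (meridian (τ • x + z)) ^ 2 := by
  obtain ⟨M₀, hM₀⟩ := (hQ.isNSIStructure 0).exists_f_le
  obtain ⟨M₁, hM₁⟩ := (hQ.isNSIStructure 1).exists_f_le
  -- a positive bound `S` of `f₁ + f₂`
  set S : ℝ := |M₀| + |M₁| + 1 with hS
  have hSpos : 0 < S := by positivity
  have hFS : ∀ q, f 0 q + f 1 q ≤ S := fun q => by
    have h0 := (hM₀ q).trans (le_abs_self M₀)
    have h1 := (hM₁ q).trans (le_abs_self M₁)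
    linarith
  have hF0 : ∀ q, 0 ≤ f 0 q + f 1 q := fun q =>
    add_nonneg ((hQ.isNSIStructure 0).f_nonneg q) ((hQ.isNSIStructure 1).f_nonneg q)
  -- `g² = τ⁻² + θ/(2S²)`
  have hc : 0 < θ / (2 * S ^ 2) := by positivity
  refine ⟨Real.sqrt (τ⁻¹ ^ 2 + θ / (2 * S ^ 2)), ?_, fun x hx => ?_⟩
  · calc τ⁻¹ = Real.sqrt (τ⁻¹ ^ 2) := (Real.sqrt_sq (inv_nonneg.2 hτ.le)).symm
      _ < Real.sqrt (τ⁻¹ ^ 2 + θ / (2 * S ^ 2)) :=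
        Real.sqrt_lt_sqrt (sq_nonneg _) (by linarith)
  · rw [Real.sq_sqrt (by positivity)]
    have hgx := hgain x hx
    set F : ℝ := f 0 (meridian x) + f 1 (meridian x) with hF
    have hF1 : F ^ 2 ≤ S ^ 2 := pow_le_pow_left₀ (hF0 _) (hFS _) 2
    have h2 : θ / (2 * S ^ 2) * F ^ 2 ≤ θ / 2 := by
      calc θ / (2 * S ^ 2) * F ^ 2 ≤ θ / (2 * S ^ 2) * S ^ 2 :=
            mul_le_mul_of_nonneg_left hF1 hc.le
        _ = θ / 2 := by field_simp
    calc (τ⁻¹ ^ 2 + θ / (2 * S ^ 2)) * F ^ 2 + θ / 2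
        = τ⁻¹ ^ 2 * F ^ 2 + (θ / (2 * S ^ 2) * F ^ 2 + θ / 2) := by ring
      _ ≤ τ⁻¹ ^ 2 * F ^ 2 + θ := by linarith
      _ ≤ H 1 T (meridian (τ • x + z)) ^ 2 := hgx

/-- **Proposition 4.2 with super-similar gain: the input of §4.1 yields profile data
(`IsNSIProfileData`, as in `IsQData.exists_profileData`) whose profiles moreover satisfy
`g (qᵏ₁ + qᵏ₂)(0)(R⁻¹x) ≤ (qᵏ₁ + qᵏ₂)(T)(R⁻¹(Γx))` on `G` for some `g > τ⁻¹`** — the §4.1–4.2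
construction run with tolerance `ε ≤ θ/2`. [cite: Ozanski2017NSISingular, Prop. 4.2 and §4.1–4.2]
[cite: Scheffer1985, Lemma 3.3] -/
theorem exists_superProfileData (hQ : IsQData U V f φ ψ H T δ κ a) {τ : ℝ} (hτ : 0 < τ) {z : EuclideanSpace ℝ (Fin 3)}
    {θ : ℝ} (hθ : 0 < θ)
    (hgain : ∀ x ∈ revolve (closure (U 0) ∪ closure (U 1)),
      τ⁻¹ ^ 2 * (f 0 (meridian x) + f 1 (meridian x)) ^ 2 + θ ≤ H 1 T (meridian (τ • x + z)) ^ 2) :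
    ∃ g : ℝ, τ⁻¹ < g ∧
      ∃ (η δ' : ℝ) (C₀ C₁ : Set (ℝ × ℝ)) (a₀ a₁ : ℝ → ℝ) (Q₀ Q₁ : ℝ → ℝ × ℝ → ℝ),
        IsNSIProfileData (U 0) (U 1) (V 0) (V 1) (f 0) (f 1) T τ z η δ' C₀ C₁ a₀ a₁ Q₀ Q₁ ∧
        ∀ x ∈ revolve (closure (U 0) ∪ closure (U 1)),
          g * (Q₀ 0 (meridian x) + Q₁ 0 (meridian x)) ≤
            Q₀ T (meridian (τ • x + z)) + Q₁ T (meridian (τ • x + z)) := by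
  obtain ⟨g, hgτ, hgain'⟩ := exists_superGain_margin hQ hτ hθ hgain
  have hg0 : 0 ≤ g := le_of_lt (lt_trans (inv_pos.2 hτ) hgτ)
  obtain ⟨μ, hμ, hμle⟩ := hQ.exists_margin
  obtain ⟨B, hB0, hB⟩ := hQ.exists_abs_V_le
  obtain ⟨K, hK0, hK⟩ := exists_pressure_constant U
  have hδ := hQ.δ_pos
  obtain ⟨ε, hεpos, hεμ, hεθ, hεδ⟩ := exists_tolerance hμ (half_pos hθ) hδ hB0 hK0
  have hεθ' : ε ≤ θ := hεθ.trans (half_le_self hθ.le)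
  obtain ⟨Kk, hKk⟩ := hQ.exists_good hεpos
  have hg : Good a V H T Kk ε := hKk Kk le_rfl
  have hposT : ∀ i, ∀ t ∈ Icc (0 : ℝ) T, ∀ x ∈ U i,
      (V i x).1 ^ 2 + (V i x).2 ^ 2 < qRad f φ δ κ a V H Kk i t x :=
    fun i t ht x hx => hQ.sq_lt_qRad_of_mem_Icc hg hμle hεμ i ht hx
  obtain ⟨η, hη, hposS⟩ := hQ.exists_eta Kk hposT
  have hηI : Icc (0 : ℝ) T ⊆ Ioo (-η) (T + η) := fun t ht => ⟨by linarith [ht.1], by linarith [ht.2]⟩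
  have hκI : ∀ t ∈ Icc (0 : ℝ) T, κ t ∈ Icc (-1 : ℝ) (T + 1) := fun t ht => by
    rw [hQ.κ_eq t ht]; exact ⟨by linarith [ht.1], by linarith [ht.2]⟩
  have hS0 := hQ.isNSIStructure 0
  have hS1 := hQ.isNSIStructure 1
  refine ⟨g, hgτ, η, δ / 4, {x | 1 / 4 ≤ φ 0 x}, {x | 1 / 4 ≤ φ 1 x}, a Kk 0, a Kk 1,
    qProf f φ δ κ a V H Kk 0, qProf f φ δ κ a V H Kk 1, ?_,
    fun x hx => superGain_qProf hQ hg hg0 hεθ hgain' hx⟩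
  exact
    { η_pos := hη
      δ_pos := by positivity
      a₁_smooth := hQ.osc.contDiff Kk 0
      a₂_smooth := hQ.osc.contDiff Kk 1
      abs_a₁_le := fun t => hQ.osc.abs_le Kk 0 t
      abs_a₂_le := fun t => hQ.osc.abs_le Kk 1 t
      isClosed₁ := isClosed_le continuous_const hS0.φ_smooth.continuous
      isClosed₂ := isClosed_le continuous_const hS1.φ_smooth.continuous
      subset₁ := hS0.setOf_le_φ_subset
      subset₂ := hS1.setOf_le_φ_subset
      tsupport_v₁ := fun x hx => by
        have h1 : φ 0 x = 1 := hS0.tsupport_v hx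
        show (1 : ℝ) / 4 ≤ φ 0 x
        rw [h1]; norm_num
      tsupport_v₂ := fun x hx => by
        have h1 : φ 1 x = 1 := hS1.tsupport_v hx
        show (1 : ℝ) / 4 ≤ φ 1 x
        rw [h1]; norm_num
      Q₁_smooth := hQ.contDiffOn_qProf Kk 0 (hposS 0)
      Q₂_smooth := hQ.contDiffOn_qProf Kk 1 (hposS 1)
      Q₁_nonneg := fun t _ x => qProf_nonneg Kk 0 t x
      Q₂_nonneg := fun t _ x => qProf_nonneg Kk 1 t x
      Q₁_eq_zero := fun t _ x hx => hQ.qProf_eq_zero Kk 0 t hx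
      Q₂_eq_zero := fun t _ x hx => hQ.qProf_eq_zero Kk 1 t hx
      sq_lt₁ := fun t ht x hx => by
        rw [qProf_sq (hQ.qRad_nonneg Kk 0 (hposS 0 t ht) x)]
        exact hposS 0 t ht x hx
      sq_lt₂ := fun t ht x hx => by
        rw [qProf_sq (hQ.qRad_nonneg Kk 1 (hposS 1 t ht) x)]
        exact hposS 1 t ht x hx
      initial₁ := fun x => hQ.qProf_zero Kk 0 x
      initial₂ := fun x => hQ.qProf_zero Kk 1 x
      inner₁ := fun t ht x hx => hQ.inner_ineq hg hεpos.le hK0 hK hB hεδ hposS hηI 0 ht hx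
      inner₂ := fun t ht x hx => hQ.inner_ineq hg hεpos.le hK0 hK hB hεδ hposS hηI 1 ht hx
      outer₁ := fun t ht x hx =>
        hQ.outer_deriv hposS hηI 0 ht (lt_of_lt_of_le (not_le.1 hx) (by norm_num))
      outer₂ := fun t ht x hx =>
        hQ.outer_deriv hposS hηI 1 ht (lt_of_lt_of_le (not_le.1 hx) (by norm_num))
      opL₁ := fun t ht x hx _ => mul_nonneg (qProf_nonneg Kk 0 t x)
        ((hQ.crit_qProf 0 (hposS 0) (hηI ht) (hκI t ht)).2.1 x (not_le.1 hx))
      opL₂ := fun t ht x hx _ => mul_nonneg (qProf_nonneg Kk 1 t x)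
        ((hQ.crit_qProf 1 (hposS 1) (hηI ht) (hκI t ht)).2.1 x (not_le.1 hx))
      gain := fun x hx => hQ.gain_qProf hg hτ hεθ' hgain hx }

end QLevel

/-! ### From an arrangement: a block with super-similar gain -/

section Arrangement

variable {U₁ U₂ : Set (ℝ × ℝ)} {v₁ : ℝ × ℝ → ℝ × ℝ} {f₁ φ₁ : ℝ × ℝ → ℝ} {v₂ : ℝ × ℝ → ℝ × ℝ}
  {f₂ φ₂ : ℝ × ℝ → ℝ} {T τ : ℝ} {z : EuclideanSpace ℝ (Fin 3)}

/-- **The gain of magnitude of the block `u = u[a₁v₁,Q₁] + u[a₂v₂,Q₂]` is that of its profiles**: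
if `g (Q₁ + Q₂)(0)(R⁻¹x) ≤ (Q₁ + Q₂)(T)(R⁻¹(Γx))` on `G` then `g|u(x,0)| ≤ |u(Γx,T)|` for every
`x ∈ ℝ³` (on `G` by `|u| = (Q₁ + Q₂) ∘ R⁻¹`; off `G`, `u(x,0) = 0`). Twin of
`IsNSIProfileData.gain_profileField` (`g = τ⁻¹`). [cite: Ozanski2017NSISingular, Prop. 4.2 (ii)]
[cite: Scheffer1985, Lemma 3.1 (3.14)] -/
theorem superGain_profileField {η δ : ℝ} {C₁ C₂ : Set (ℝ × ℝ)} {a₁ a₂ : ℝ → ℝ}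
    {Q₁ Q₂ : ℝ → ℝ × ℝ → ℝ}
    (h : IsNSIProfileData U₁ U₂ v₁ v₂ f₁ f₂ T τ z η δ C₁ C₂ a₁ a₂ Q₁ Q₂)
    (hA : IsNSIArrangement U₁ U₂ v₁ f₁ φ₁ v₂ f₂ φ₂ T τ z) {g : ℝ}
    (hgain : ∀ x ∈ revolve (closure U₁ ∪ closure U₂),
      g * (Q₁ 0 (meridian x) + Q₂ 0 (meridian x)) ≤
        Q₁ T (meridian (τ • x + z)) + Q₂ T (meridian (τ • x + z)))
    (x : EuclideanSpace ℝ (Fin 3)) :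
    g * ‖profileField v₁ v₂ a₁ a₂ Q₁ Q₂ 0 x‖ ≤ ‖profileField v₁ v₂ a₁ a₂ Q₁ Q₂ T (τ • x + z)‖ := by
  by_cases hx : x ∈ revolve (closure U₁ ∪ closure U₂)
  · rw [h.norm_profileField hA (h.zero_mem hA), h.norm_profileField hA (h.T_mem hA)]
    exact hgain x hx
  · rw [h.profileField_eq_zero hA (h.zero_mem hA) (by simpa using hx), norm_zero, mul_zero]
    exact norm_nonneg _

/-- **Every geometric arrangement carries a classical block with super-similar gain**: for an
`IsNSIArrangement` with similarity `Γx = τx + z` there are `g₀ > τ⁻¹`, `ν₀ > 0` and a classical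
block `u` (`IsNSIBlock T ν₀ τ z G u`, `G = R(Ū₁ ∪ Ū₂)`; Ożański Prop. 4.2, Scheffer Lemma 3.3)
with `g|u(x,0)| ≤ |u(Γx,T)|` for all `x` and all `g ≤ g₀` (Lemma 4.1's gain (4.11) is strict with
margin `θ > 0`; §4.1–4.2 run at tolerance `θ/2`).
[cite: Ozanski2017NSISingular, Lemma 4.1 (4.11), Prop. 4.2, §4.2] [cite: Scheffer1985, Lemmas 3.1–3.3] -/
theorem exists_superGainBlock_of_isNSIArrangement
    (hA : IsNSIArrangement U₁ U₂ v₁ f₁ φ₁ v₂ f₂ φ₂ T τ z) :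
    ∃ (g₀ ν₀ : ℝ) (u : ℝ → EuclideanSpace ℝ (Fin 3) → EuclideanSpace ℝ (Fin 3)), τ⁻¹ < g₀ ∧
      IsNSIBlock T ν₀ τ z (revolve (closure U₁ ∪ closure U₂)) u ∧
      ∀ g ≤ g₀, ∀ x : EuclideanSpace ℝ (Fin 3), g * ‖u 0 x‖ ≤ ‖u T (τ • x + z)‖ := by
  obtain ⟨δ, κ, ψ₁, ψ₂, m₁, m₂, θ, hH⟩ := hA.exists_hProfileData
  obtain ⟨a, ha⟩ := exists_isOscFamily hA.T_pos
  have hQ := hH.isQData hA ha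
  obtain ⟨g₀, hg₀, η, δ', C₀, C₁, a₀, a₁, Q₀, Q₁, hP, hsuper⟩ :=
    exists_superProfileData hQ hA.τ_mem.1 hH.θ_pos hH.gain
  obtain ⟨ν₀, hblock⟩ := hP.isNSIBlock_profileField hA
  refine ⟨g₀, ν₀, _, hg₀, hblock, fun g hg x => ?_⟩
  exact (mul_le_mul_of_nonneg_right hg (norm_nonneg _)).trans
    (superGain_profileField hP hA hsuper x)

end Arrangement

/-! ### The unconditional statement -/

/-- **A classical NSI block with super-similar gain exists**: there are `T, ν₀ > 0`,
`τ ∈ (0,1)`, `z`, a compact `G` with `Γ(G) ⊆ G`, `Γx = τx + z`, and a smooth compactly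
supported divergence-free `u` on `[0,T] × ℝ³` satisfying the pointwise Navier–Stokes
inequality for every `ν ∈ [0,ν₀]` (`IsNSIBlock`), `u(·,0) ≢ 0`, together with a constant
`g > τ⁻¹` such that `g|u(x,0)| ≤ |u(Γx,T)|` for all `x` — from the proved arrangement of
Ożański §5 (`NSIArrangementExists_holds`). With `σ := τ/g < τ²` as time ratio of the switching,
the resulting cascade has `(T₀ - t)^{1/2}‖𝔲(t)‖_∞ → ∞` (Type II); brick B1 of the model-class
counterexample «NSI admits Type-II blow-up» to rate-blind exclusions of `NoTypeII`.
[cite: Ozanski2017NSISingular, §2 (2.2), Lemma 4.1 (4.11), Prop. 4.2, §5]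
[cite: Scheffer1985, Lemmas 2.1, 3.3, §6] -/
theorem exists_superGain_nsiBlock :
    ∃ (T ν₀ τ : ℝ) (z : EuclideanSpace ℝ (Fin 3)) (G : Set (EuclideanSpace ℝ (Fin 3))) (u : ℝ → EuclideanSpace ℝ (Fin 3) → EuclideanSpace ℝ (Fin 3)) (g : ℝ),
      IsNSIBlock T ν₀ τ z G u ∧ τ⁻¹ < g ∧ ∀ x : EuclideanSpace ℝ (Fin 3), g * ‖u 0 x‖ ≤ ‖u T (τ • x + z)‖ := by
  obtain ⟨U₁, U₂, v₁, f₁, φ₁, v₂, f₂, φ₂, T, τ, z, hA⟩ := NSIArrangementExists_holds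
  obtain ⟨g₀, ν₀, u, hg₀, hblock, hsuper⟩ := exists_superGainBlock_of_isNSIArrangement hA
  exact ⟨T, ν₀, τ, z, _, u, g₀, hblock, hg₀, hsuper g₀ le_rfl⟩

/-- **Equivalently, in exponent form: a block whose gain exponent exceeds the similarity
exponent** — `|u(Γx,T)| ≥ (gτ)·τ⁻¹|u(x,0)|` with `gτ > 1` (the printed block: `gτ = 1`).
[cite: Ozanski2017NSISingular, §2 (2.2)] -/
theorem exists_superGain_nsiBlock' :
    ∃ (T ν₀ τ : ℝ) (z : EuclideanSpace ℝ (Fin 3)) (G : Set (EuclideanSpace ℝ (Fin 3))) (u : ℝ → EuclideanSpace ℝ (Fin 3) → EuclideanSpace ℝ (Fin 3)) (l : ℝ), 1 < l ∧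
      IsNSIBlock T ν₀ τ z G u ∧ ∀ x : EuclideanSpace ℝ (Fin 3), l * (τ⁻¹ * ‖u 0 x‖) ≤ ‖u T (τ • x + z)‖ := by
  obtain ⟨T, ν₀, τ, z, G, u, g, hblock, hg, hsuper⟩ := exists_superGain_nsiBlock
  have hτ := hblock.τ_pos
  refine ⟨T, ν₀, τ, z, G, u, g * τ, ?_, hblock, fun x => ?_⟩
  · have := mul_lt_mul_of_pos_right hg hτ
    rwa [inv_mul_cancel₀ hτ.ne'] at this
  · have e : g * τ * (τ⁻¹ * ‖u 0 x‖) = g * ‖u 0 x‖ := by field_simp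
    rw [e]; exact hsuper x

end Summit.NavierStokesRegularity.NavierStokesRegularity.Theorems.TypeIliouvilleNoTypeIINegative

end
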